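import Mathlib
import HarnessLib
import Literature.AlgebraicGeometry.Resolution.AffineBlowup
import Summits.ResolutionOfSingularities.ResolutionOfSingularities.Theorems.WildQuotientsWildQuotientResolutionJordanFiveFrameDefs
import Summits.ResolutionOfSingularities.ResolutionOfSingularities.Theorems.WildQuotientsWildQuotientResolutionJordanFourTwistedChartDefs

/-!
# RUNG V5 (J₅): the W₁ TERM OF RECORD `chartW₁ = D₊(H′²t · T′²H′t²) = D₊(H′²t) ⊓ D₊(T′²H′t²)` of `Bl_{I₁₂} 𝔸ⁿ`

(crux stmt-ResolutionOfSingularities-15640 `WildQuotients.WildQuotientResolution`, line `Sketch`;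
chain w45c RUNG V5 `JordanFive.jordanFive_hasResolution_of_bricks` (res-L1-w45c-lead-1 BRICK LIST v1
2026-08-27T10:32:12Z, `L/res-L1-w45c-lead-1/stubs/J5Bricks.lean` brick `W₁`), res-L1-w45c-plan-1
RULING 10:50Z («W₁ := stub-1 names it … μ₃-vertex open ∋ C_b as D₊ of a σ-invariant Rees section,
chartW pattern»); named on STATUS 2026-08-27T10:57:17Z. Pattern and wording of
`…JordanFourChartWDefs` (res-L1-w45c-stub-5, p504103). [OURS · L1 W4.5c] — NOT a statement of any
manuscript (Hironaka 2017 is consumed nowhere); replaces the role of no printed item. Prover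
res-L1-w45c-stub-1. AI-written Lean, kernel-checked; weaker than expert review.)

`I₁₂ = JordanFive.I12 = ⟨gens12⟩` (res-L1-w45c-lead-1, p523816), `H′ = JordanFour.hPrime`,
`T′ = JordanFour.tPrime` (p499121; `σ`-invariant for the `J₅` law: `JordanFive.map_hPrime`,
`JordanFive.map_tPrime`, p522729). The twisted `μ₃`-vertex open is the exact twin of the J₄
`μ₂`-vertex open `chartW = D₊(T′t) ⊓ D₊(H′³t²)`: a degree-`1` invariant section that GENERATES the
centre on the universal twisted chart (`ψ₅(H′²) = l¹²Q²`, `ψ₅(I₁₂) ⊆ (l¹²)`) times a degree-`2`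
invariant section inverting `θ⁻¹ = T′²/H′³ ↦ 1/Q` (`ψ₅(T′²H′) = l²⁴Q³`), so that `Γ(W₁)` maps
ISOMORPHICALLY-by-design onto `(μ₃-weight-0 part of k[l,A,ξ,η₁,η₂,pass])[1/Q]`:
* `JordanFive.hPrime_sq_mem_I12` (`H′² = g₁ + g₃₉ + 4g₅ − 2g₃₅ − 4g₈ + 4g₃₄`),
  `JordanFive.tPrime_sq_mul_hPrime_mem_I12_sq` (`T′²H′ ∈ I₁₂²`, 26 monomials, each an explicit
  `gᵢgⱼ`-multiple);
* `JordanFive.tSqHT2` — the degree-2 Rees element `T′²H′ t²`; `JordanFive.chartW₁` — the open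
  `D₊(H′²t · T′²H′t²)` of `Proj R[I₁₂t]`; `chartW₁_section_mem` (degree 3), `coe_chartW₁_section`;
* `JordanFive.isAffineOpen_chartW₁` (brick `HW₁aff`: `Proj.isAffineOpen_basicOpen`) and
  `JordanFive.chartW₁_eq_inf` (`chartW₁ = D₊(H′²t) ⊓ D₊(T′²H′t²)`).
Root-chart check of the loci (STATUS 10:57:17Z; typed by the W-side owner): `C_b ⊆ W₁`,
`W₁ ∩ edgeSurface = ∅`, `W₁ ∩ C_a = ∅`.
-/

-- single-problem summit: the doubled namespace component `ResolutionOfSingularities` is forced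
set_option linter.dupNamespace false

noncomputable section

open MvPolynomial Polynomial AlgebraicGeometry Literature.AlgebraicGeometry.Resolution

namespace Summit.ResolutionOfSingularities.ResolutionOfSingularities.Theorems.WildQuotientResolution.JordanFive

variable (k : Type) [Field k] (n : ℕ) (a b c d : Fin n)

/-- **`H′² ∈ I₁₂`**: `H′² = x_b⁴ + x_a²x_b² + 4x_a²x_c² − 2x_ax_b³ − 4x_ax_b²x_c + 4x_a²x_bx_c
= g₁ + g₃₉ + 4g₅ − 2g₃₅ − 4g₈ + 4g₃₄`. [OURS · L1 W4.5c] -/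
theorem hPrime_sq_mem_I12 : JordanFour.hPrime k n a b c ^ 2 ∈ I12 k n a b c d := by
  have hg := gens12_mem_I12 k n a b c d
  have g1 : gens12 k n a b c d 1 = X b ^ 4 := by simp [gens12]
  have g5 : gens12 k n a b c d 5 = X a ^ 2 * X c ^ 2 := by simp [gens12]
  have g8 : gens12 k n a b c d 8 = X a * X b ^ 2 * X c := by simp [gens12]
  have g34 : gens12 k n a b c d 34 = X a ^ 2 * X b * X c := by simp [gens12]
  have g35 : gens12 k n a b c d 35 = X a * X b ^ 3 := by simp [gens12]
  have g39 : gens12 k n a b c d 39 = X a ^ 2 * X b ^ 2 := by simp [gens12]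
  have e : JordanFour.hPrime k n a b c ^ 2 =
      gens12 k n a b c d 1 + gens12 k n a b c d 39 + 4 * gens12 k n a b c d 5 -
        2 * gens12 k n a b c d 35 - 4 * gens12 k n a b c d 8 + 4 * gens12 k n a b c d 34 := by
    rw [g1, g5, g8, g34, g35, g39]
    simp only [JordanFour.hPrime]
    ring
  rw [e]
  refine Ideal.add_mem _ (Ideal.sub_mem _ (Ideal.sub_mem _ (Ideal.add_mem _ (Ideal.add_mem _ (hg 1)
    (hg 39)) (Ideal.mul_mem_left _ _ (hg 5))) (Ideal.mul_mem_left _ _ (hg 35)))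
    (Ideal.mul_mem_left _ _ (hg 8))) (Ideal.mul_mem_left _ _ (hg 34))

/-- **`T′²H′ ∈ I₁₂²`** (`26` monomials of `(4,3,2,1)`-weight `≥ 24`, each written as an explicit
multiple of a product `gᵢ gⱼ` of two generators). [OURS · L1 W4.5c] -/
theorem tPrime_sq_mul_hPrime_mem_I12_sq :
    JordanFour.tPrime k n a b c d ^ 2 * JordanFour.hPrime k n a b c ∈ I12 k n a b c d ^ 2 := by
  have hg := gens12_mem_I12 k n a b c d
  have hmul : ∀ i j : Fin 40, gens12 k n a b c d i * gens12 k n a b c d j ∈ I12 k n a b c d ^ 2 :=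
    fun i j => by rw [pow_two]; exact Ideal.mul_mem_mul (hg i) (hg j)
  have g0 : gens12 k n a b c d 0 = X a ^ 3 := by simp [gens12]
  have g1 : gens12 k n a b c d 1 = X b ^ 4 := by simp [gens12]
  have g4 : gens12 k n a b c d 4 = X a ^ 2 * X b * X d := by simp [gens12]
  have g5 : gens12 k n a b c d 5 = X a ^ 2 * X c ^ 2 := by simp [gens12]
  have g6 : gens12 k n a b c d 6 = X a ^ 2 * X c * X d ^ 2 := by simp [gens12]
  have g8 : gens12 k n a b c d 8 = X a * X b ^ 2 * X c := by simp [gens12]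
  have g9 : gens12 k n a b c d 9 = X a * X b ^ 2 * X d ^ 2 := by simp [gens12]
  have g10 : gens12 k n a b c d 10 = X a * X b * X c ^ 2 * X d := by simp [gens12]
  have g18 : gens12 k n a b c d 18 = X b ^ 3 * X c * X d := by simp [gens12]
  have g20 : gens12 k n a b c d 20 = X b ^ 2 * X c ^ 3 := by simp [gens12]
  have g34 : gens12 k n a b c d 34 = X a ^ 2 * X b * X c := by simp [gens12]
  have g35 : gens12 k n a b c d 35 = X a * X b ^ 3 := by simp [gens12]
  have g37 : gens12 k n a b c d 37 = X b ^ 3 * X c ^ 2 := by simp [gens12]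
  have g39 : gens12 k n a b c d 39 = X a ^ 2 * X b ^ 2 := by simp [gens12]
  have e : JordanFour.tPrime k n a b c d ^ 2 * JordanFour.hPrime k n a b c =
      (1) * (gens12 k n a b c d 1 * gens12 k n a b c d 1) +
      (-8) * (gens12 k n a b c d 1 * gens12 k n a b c d 8) +
      (-1) * (gens12 k n a b c d 1 * gens12 k n a b c d 35) +
      (21) * (gens12 k n a b c d 1 * gens12 k n a b c d 5) +
      (6) * (gens12 k n a b c d 1 * gens12 k n a b c d 4) +
      (6) * (gens12 k n a b c d 1 * gens12 k n a b c d 34) +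
      (-2) * (gens12 k n a b c d 1 * gens12 k n a b c d 39) +
      (-18) * (gens12 k n a b c d 0 * gens12 k n a b c d 20) +
      (-30) * (gens12 k n a b c d 0 * gens12 k n a b c d 18) +
      (-9) * (gens12 k n a b c d 0 * gens12 k n a b c d 37) +
      (-6 * X d + 10 * X c + 2 * X b + X a) * (gens12 k n a b c d 0 * gens12 k n a b c d 1) +
      (36) * (gens12 k n a b c d 0 * gens12 k n a b c d 10) +
      (9) * (gens12 k n a b c d 0 * gens12 k n a b c d 9) +
      (18 * X d - 12 * X c - 6 * X b - 2 * X a) * (gens12 k n a b c d 0 * gens12 k n a b c d 8) +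
      (-6 * X d - X a) * (gens12 k n a b c d 0 * gens12 k n a b c d 35) +
      (-18) * (gens12 k n a b c d 0 * gens12 k n a b c d 6) +
      (-9 * X d + 12 * X c + 6 * X b) * (gens12 k n a b c d 0 * gens12 k n a b c d 4) := by
    rw [g0, g1, g4, g5, g6, g8, g9, g10, g18, g20, g34, g35, g37, g39]
    simp only [JordanFour.tPrime, JordanFour.hPrime]
    ring
  rw [e]
  refine Ideal.add_mem _ (Ideal.add_mem _ (Ideal.add_mem _ (Ideal.add_mem _ (Ideal.add_mem _
    (Ideal.add_mem _ (Ideal.add_mem _ (Ideal.add_mem _ (Ideal.add_mem _ (Ideal.add_mem _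
    (Ideal.add_mem _ (Ideal.add_mem _ (Ideal.add_mem _ (Ideal.add_mem _ (Ideal.add_mem _
    (Ideal.add_mem _
    (Ideal.mul_mem_left _ _ (hmul 1 1)) (Ideal.mul_mem_left _ _ (hmul 1 8)))
    (Ideal.mul_mem_left _ _ (hmul 1 35))) (Ideal.mul_mem_left _ _ (hmul 1 5)))
    (Ideal.mul_mem_left _ _ (hmul 1 4))) (Ideal.mul_mem_left _ _ (hmul 1 34)))
    (Ideal.mul_mem_left _ _ (hmul 1 39))) (Ideal.mul_mem_left _ _ (hmul 0 20)))
    (Ideal.mul_mem_left _ _ (hmul 0 18))) (Ideal.mul_mem_left _ _ (hmul 0 37)))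
    (Ideal.mul_mem_left _ _ (hmul 0 1))) (Ideal.mul_mem_left _ _ (hmul 0 10)))
    (Ideal.mul_mem_left _ _ (hmul 0 9))) (Ideal.mul_mem_left _ _ (hmul 0 8)))
    (Ideal.mul_mem_left _ _ (hmul 0 35))) (Ideal.mul_mem_left _ _ (hmul 0 6))) ?_
  exact Ideal.mul_mem_left _ _ (hmul 0 4)

/-- **The degree-2 Rees element `T′²H′ t² ∈ R[I₁₂ t]`.** [OURS · L1 W4.5c] -/
def tSqHT2 : reesAlgebra (I12 k n a b c d) :=
  ⟨monomial 2 (JordanFour.tPrime k n a b c d ^ 2 * JordanFour.hPrime k n a b c),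
    reesAlgebra.monomial_mem.mpr (tPrime_sq_mul_hPrime_mem_I12_sq k n a b c d)⟩

/-- The underlying polynomial of `T′²H′ t²`. [folklore] -/
theorem coe_tSqHT2 :
    (tSqHT2 k n a b c d : (MvPolynomial (Fin n) k)[X]) =
      monomial 2 (JordanFour.tPrime k n a b c d ^ 2 * JordanFour.hPrime k n a b c) :=
  rfl

/-- `T′²H′ t²` is homogeneous of degree `2`. [folklore] -/
theorem tSqHT2_mem : tSqHT2 k n a b c d ∈ reesGrading (I12 k n a b c d) 2 :=
  ⟨JordanFour.tPrime k n a b c d ^ 2 * JordanFour.hPrime k n a b c, rfl⟩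

/-- **The W₁ TERM OF RECORD**: `chartW₁ = D₊(H′²t · T′²H′t²) ⊆ Bl_{I₁₂} 𝔸ⁿ = Proj R[I₁₂t]` — the
universal-twisted-chart open at the `μ₃`-vertex (`W₁ = D₊(H′²t) ∩ D(θ)`, `θ = H′³/T′² ↦ Q`).
[OURS · L1 W4.5c] -/
def chartW₁ : (affineBlowup (I12 k n a b c d)).Opens :=
  Proj.basicOpen (reesGrading _)
    (reesT (JordanFour.hPrime k n a b c ^ 2) (hPrime_sq_mem_I12 k n a b c d) * tSqHT2 k n a b c d)

/-- Unfolding `chartW₁`. [folklore] -/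
theorem chartW₁_def : chartW₁ k n a b c d = Proj.basicOpen (reesGrading _)
    (reesT (JordanFour.hPrime k n a b c ^ 2) (hPrime_sq_mem_I12 k n a b c d) * tSqHT2 k n a b c d) :=
  rfl

/-- The section `H′²t · T′²H′t²` is homogeneous of degree `3`. [folklore] -/
theorem chartW₁_section_mem :
    reesT (JordanFour.hPrime k n a b c ^ 2) (hPrime_sq_mem_I12 k n a b c d) * tSqHT2 k n a b c d ∈
      reesGrading (I12 k n a b c d) (1 + 2) :=
  SetLike.mul_mem_graded (reesT_mem _ _) (tSqHT2_mem k n a b c d)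

/-- The underlying polynomial of the section: `(H′² · T′²H′) t³ = (T′²H′³) t³`. [folklore] -/
theorem coe_chartW₁_section :
    ((reesT (JordanFour.hPrime k n a b c ^ 2) (hPrime_sq_mem_I12 k n a b c d) * tSqHT2 k n a b c d :
      reesAlgebra (I12 k n a b c d)) : (MvPolynomial (Fin n) k)[X]) =
      monomial 3 (JordanFour.hPrime k n a b c ^ 2 *
        (JordanFour.tPrime k n a b c d ^ 2 * JordanFour.hPrime k n a b c)) := by
  change (monomial 1 (JordanFour.hPrime k n a b c ^ 2)) *
    (monomial 2 (JordanFour.tPrime k n a b c d ^ 2 * JordanFour.hPrime k n a b c)) = _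
  rw [monomial_mul_monomial]

/-- **Brick `HW₁aff`: `chartW₁` is an affine open** (a basic open of `Proj` at a section of positive
degree; Mathlib `Proj.isAffineOpen_basicOpen`). [OURS · L1 W4.5c] -/
theorem isAffineOpen_chartW₁ : IsAffineOpen (chartW₁ k n a b c d) :=
  Proj.isAffineOpen_basicOpen _ _ (chartW₁_section_mem k n a b c d) (by norm_num)

/-- **`chartW₁ = D₊(H′²t) ⊓ D₊(T′²H′t²)`.** [OURS · L1 W4.5c] -/
theorem chartW₁_eq_inf : chartW₁ k n a b c d =
    Proj.basicOpen (reesGrading _)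
        (reesT (JordanFour.hPrime k n a b c ^ 2) (hPrime_sq_mem_I12 k n a b c d)) ⊓
      Proj.basicOpen (reesGrading _) (tSqHT2 k n a b c d) :=
  Proj.basicOpen_mul _ _ _

end Summit.ResolutionOfSingularities.ResolutionOfSingularities.Theorems.WildQuotientResolution.JordanFive

end
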